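import Mathlib
import Literature.MathematicalPhysics.KineticTheory.HardSphereEuler
import Summits.AtomisticToContinuum.HydrodynamicLimit.Theorems.JParityClosureParityInBandEnergyTight
import Summits.AtomisticToContinuum.HydrodynamicLimit.Theorems.OneFlightGossipEngineOneFlightLayeredChaosJunkInvisibility
import Summits.AtomisticToContinuum.HydrodynamicLimit.Theorems.OneFlightGossipEngineOneFlightLayeredChaosCoarsePast
import HarnessLib

/-!
# `OneFlightGossipEngine.OneFlightLayeredChaos` — every event of the crux's σ-algebra `𝒢` has a measurable version
(crux stmt-AtomisticToContinuum-14535, helper for every line: the end of the measurability chain)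

Assembly of `…JunkInvisibility` (generic), `…CoarsePast` (the generating map
`z ↦ (Φ.coarsePastOf (coarseCell r) i n z, Φ.nthPartnerOf i n z)` is measurable on `Φ.good`) and
`localGibbsLaw_compl_good` (the crux's law `P` does not charge `(Φ.good)ᶜ`, file `JParityClosureParityInBandEnergyTight`):
for every flow `Φ` — junk off the good set included — and every `E` measurable for the crux's
`MeasurableSpace.comap (fun z => (coarsePastOf, nthPartnerOf)) inferInstance`, there is an honestly measurable `E'`
with `P (X ∩ E) = P (X ∩ E')` for ALL sets `X` (outer measures), so in the crux's defect
`|P (W ∩ A ∩ E) − u·P (W ∩ E)|` one may replace `E` by `E'` (and likewise `W`, `A` by their good-set versions,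
files `…WindowEvent`, `…KickEvent`), after which `𝒢` is a genuine sub-σ-algebra and conditional expectations apply
(file `…EventDuality`). No dynamics, no new definitions.
-/

open MeasureTheory
open Literature.Analysis.FluidPDE Literature.MathematicalPhysics.KineticTheory

namespace Summit.AtomisticToContinuum.HydrodynamicLimit.Theorems

/-- **Measurable versions of `𝒢`-events.** For the crux's law `P = localGibbsLaw σ a₀ u₀ θ₀ N Φ`, mesh `r`,
particle `i`, collision index `n`: every `E` measurable for
`MeasurableSpace.comap (fun z => (Φ.coarsePastOf (Torus.coarseCell r) i n z, Φ.nthPartnerOf i n z)) inferInstance`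
has a measurable version `E'` with `P (X ∩ E) = P (X ∩ E')` for every set `X`. [folklore] -/
theorem exists_measurable_version_of_pastSigma_event : ∀ (σ : ℝ) (a₀ θ₀ : Literature.MathematicalPhysics.KineticTheory.T3 → ℝ) (u₀ : Literature.MathematicalPhysics.KineticTheory.T3 → Literature.MathematicalPhysics.KineticTheory.V3) (N : ℕ) (Φ : Literature.Analysis.FluidPDE.HardSphereFlow (Literature.Analysis.FluidPDE.Torus.geometry (Fin 3)) (Literature.MathematicalPhysics.KineticTheory.hsDiameter σ N) (N + 1)) (r : ℝ) (i : Fin (N + 1)) (n : ℕ) (E : Set (Literature.Analysis.FluidPDE.Config (N + 1) (Fin 3) Literature.MathematicalPhysics.KineticTheory.T3)), MeasurableSet[MeasurableSpace.comap (fun z => (Φ.coarsePastOf (Literature.Analysis.FluidPDE.Torus.coarseCell r) i n z, Φ.nthPartnerOf i n z)) inferInstance] E → ∃ E' : Set (Literature.Analysis.FluidPDE.Config (N + 1) (Fin 3) Literature.MathematicalPhysics.KineticTheory.T3), MeasurableSet E' ∧ ∀ X : Set (Literature.Analysis.FluidPDE.Config (N + 1) (Fin 3) Literature.MathematicalPhysics.KineticTheory.T3),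 Literature.MathematicalPhysics.KineticTheory.localGibbsLaw σ a₀ u₀ θ₀ N Φ (X ∩ E) = Literature.MathematicalPhysics.KineticTheory.localGibbsLaw σ a₀ u₀ θ₀ N Φ (X ∩ E') := by
  intro σ a₀ θ₀ u₀ N Φ r i n E hE
  classical
  have hf : Measurable (Φ.good.restrict fun z : Config (N + 1) (Fin 3) T3 =>
      (Φ.coarsePastOf (Torus.coarseCell r) i n z, Φ.nthPartnerOf i n z)) :=
    measurable_coarsePastOf_nthPartnerOf_restrict Φ r i n
  let y₀ : ((Fin (N + 1) → (Fin 3 → ℤ) × EuclideanSpace ℝ (Fin 3)) ×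
      (Fin (N + 1) → (Fin 3 → ℤ) × EuclideanSpace ℝ (Fin 3))) × Fin (N + 1) :=
    ((fun _ => (0, 0), fun _ => (0, 0)), 0)
  obtain ⟨E', -, hE', hXE⟩ := exists_measurable_version_of_comap_event (localGibbsLaw σ a₀ u₀ θ₀ N Φ)
    Φ.measurableSet_good (localGibbsLaw_compl_good σ a₀ θ₀ u₀ N Φ) hf y₀ E hE
  exact ⟨E', hE', hXE⟩


/-- **`𝒢` is `P`-equivalent to a genuine sub-σ-algebra.** For the crux's law `P` and generating map
`F z = (Φ.coarsePastOf (coarseCell r) i n z, Φ.nthPartnerOf i n z)` there is a sub-σ-algebra `m` of the ambient (Borel/pi)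
σ-algebra `MeasurableSpace.pi` (named explicitly: inside the `∃ m`, `inferInstance` would resolve to `m` itself) —
namely `comap` of the modification of `F` by a constant off `Φ.good` — such that every `comap F`-event has an
`m`-version and every `m`-event has a `comap F`-version, versions having the same trace (outer) measures `P (X ∩ ·)` on
every set `X`. So `sup` over `𝒢`-events of the crux's defect equals `sup` over `m`-events, where conditional expectation
(file `…EventDuality`) applies. [folklore] -/
theorem pastSigma_equivalent_subSigma (σ : ℝ) (a₀ θ₀ : T3 → ℝ) (u₀ : T3 → V3) (N : ℕ)
    (Φ : HardSphereFlow (Torus.geometry (Fin 3)) (hsDiameter σ N) (N + 1)) (r : ℝ) (i : Fin (N + 1)) (n : ℕ) :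
    ∃ m : MeasurableSpace (Config (N + 1) (Fin 3) T3),
      m ≤ (MeasurableSpace.pi : MeasurableSpace (Config (N + 1) (Fin 3) T3)) ∧
      (∀ E : Set (Config (N + 1) (Fin 3) T3),
        MeasurableSet[MeasurableSpace.comap (fun z => (Φ.coarsePastOf (Torus.coarseCell r) i n z,
          Φ.nthPartnerOf i n z)) inferInstance] E →
        ∃ E' : Set (Config (N + 1) (Fin 3) T3), MeasurableSet[m] E' ∧
          ∀ X : Set (Config (N + 1) (Fin 3) T3),
            localGibbsLaw σ a₀ u₀ θ₀ N Φ (X ∩ E) = localGibbsLaw σ a₀ u₀ θ₀ N Φ (X ∩ E')) ∧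
      (∀ E' : Set (Config (N + 1) (Fin 3) T3), MeasurableSet[m] E' →
        ∃ E : Set (Config (N + 1) (Fin 3) T3),
          MeasurableSet[MeasurableSpace.comap (fun z => (Φ.coarsePastOf (Torus.coarseCell r) i n z,
            Φ.nthPartnerOf i n z)) inferInstance] E ∧
          ∀ X : Set (Config (N + 1) (Fin 3) T3),
            localGibbsLaw σ a₀ u₀ θ₀ N Φ (X ∩ E) = localGibbsLaw σ a₀ u₀ θ₀ N Φ (X ∩ E')) := by
  classical
  set F : Config (N + 1) (Fin 3) T3 → _ := fun z : Config (N + 1) (Fin 3) T3 =>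
    (Φ.coarsePastOf (Torus.coarseCell r) i n z, Φ.nthPartnerOf i n z) with hF
  have hf : Measurable (Φ.good.restrict F) := measurable_coarsePastOf_nthPartnerOf_restrict Φ r i n
  let y₀ : ((Fin (N + 1) → (Fin 3 → ℤ) × EuclideanSpace ℝ (Fin 3)) ×
      (Fin (N + 1) → (Fin 3 → ℤ) × EuclideanSpace ℝ (Fin 3))) × Fin (N + 1) :=
    ((fun _ => (0, 0), fun _ => (0, 0)), 0)
  refine ⟨MeasurableSpace.comap (Φ.good.piecewise F (fun _ => y₀)) inferInstance,
    comap_piecewise_le Φ.measurableSet_good hf y₀, fun E hE => ?_, fun E' hE' => ?_⟩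
  · obtain ⟨E', hm, -, hXE⟩ := exists_measurable_version_of_comap_event (localGibbsLaw σ a₀ u₀ θ₀ N Φ)
      Φ.measurableSet_good (localGibbsLaw_compl_good σ a₀ θ₀ u₀ N Φ) hf y₀ E hE
    exact ⟨E', hm, hXE⟩
  · rcases hE' with ⟨S, hS, rfl⟩
    refine ⟨F ⁻¹' S, ⟨S, hS, rfl⟩, fun X => ?_⟩
    exact measure_inter_congr_of_symmDiff_null (localGibbsLaw σ a₀ u₀ θ₀ N Φ) Φ.goodᶜ
      (localGibbsLaw_compl_good σ a₀ θ₀ u₀ N Φ) (preimage_symmDiff_preimage_piecewise_subset Φ.good F y₀ S) X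


/-- **Good-set versions of arbitrary events.** If `μ goodᶜ = 0` then `μ (X ∩ S) = μ (X ∩ (good ∩ S))` for all sets
`X, S` (outer measures): in the crux's defect, `W` and `A` may be replaced by `Φ.good ∩ W`, `Φ.good ∩ A`, which are
measurable (files `…WindowEvent`, `…KickEvent`). [folklore] -/
theorem measure_inter_congr_good {Ω : Type*} [MeasurableSpace Ω] (μ : Measure Ω) {good : Set Ω}
    (hnull : μ goodᶜ = 0) (X S : Set Ω) : μ (X ∩ S) = μ (X ∩ (good ∩ S)) :=
  measure_inter_congr_of_symmDiff_null μ goodᶜ hnull (fun x hx => by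
    rcases hx with ⟨h1, h2⟩ | ⟨h1, h2⟩
    · exact fun hg => h2 ⟨hg, h1⟩
    · exact absurd h1.2 h2) X

/-- The crux's three measures with `W, A` replaced by their good-set versions and `E` by a measurable version:
for `P = localGibbsLaw σ a₀ u₀ θ₀ N Φ` and any sets `W, A` and any `𝒢`-event `E` there is a measurable `E'` with
`P (W ∩ A ∩ E) = P ((Φ.good ∩ W) ∩ (Φ.good ∩ A) ∩ E')` and `P (W ∩ E) = P ((Φ.good ∩ W) ∩ E')`. [folklore] -/
theorem crux_measures_good_versions (σ : ℝ) (a₀ θ₀ : T3 → ℝ) (u₀ : T3 → V3) (N : ℕ)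
    (Φ : HardSphereFlow (Torus.geometry (Fin 3)) (hsDiameter σ N) (N + 1)) (r : ℝ) (i : Fin (N + 1)) (n : ℕ)
    (W A E : Set (Config (N + 1) (Fin 3) T3))
    (hE : MeasurableSet[MeasurableSpace.comap (fun z => (Φ.coarsePastOf (Torus.coarseCell r) i n z,
      Φ.nthPartnerOf i n z)) inferInstance] E) :
    ∃ E' : Set (Config (N + 1) (Fin 3) T3), MeasurableSet E' ∧
      localGibbsLaw σ a₀ u₀ θ₀ N Φ (W ∩ A ∩ E) =
        localGibbsLaw σ a₀ u₀ θ₀ N Φ ((Φ.good ∩ W) ∩ (Φ.good ∩ A) ∩ E') ∧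
      localGibbsLaw σ a₀ u₀ θ₀ N Φ (W ∩ E) = localGibbsLaw σ a₀ u₀ θ₀ N Φ ((Φ.good ∩ W) ∩ E') := by
  obtain ⟨E', hE', hXE⟩ := exists_measurable_version_of_pastSigma_event σ a₀ θ₀ u₀ N Φ r i n E hE
  have hnull := localGibbsLaw_compl_good σ a₀ θ₀ u₀ N Φ
  set P := localGibbsLaw σ a₀ u₀ θ₀ N Φ with hP
  refine ⟨E', hE', ?_, ?_⟩
  · calc P (W ∩ A ∩ E) = P ((W ∩ A) ∩ E') := hXE (W ∩ A)
      _ = P (E' ∩ (W ∩ A)) := by rw [Set.inter_comm]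
      _ = P (E' ∩ (Φ.good ∩ (W ∩ A))) := measure_inter_congr_good P hnull E' (W ∩ A)
      _ = P ((Φ.good ∩ W) ∩ (Φ.good ∩ A) ∩ E') := by
          congr 1; ext z; simp only [Set.mem_inter_iff]; tauto
  · calc P (W ∩ E) = P (W ∩ E') := hXE W
      _ = P (E' ∩ W) := by rw [Set.inter_comm]
      _ = P (E' ∩ (Φ.good ∩ W)) := measure_inter_congr_good P hnull E' W
      _ = P ((Φ.good ∩ W) ∩ E') := by rw [Set.inter_comm]

end Summit.AtomisticToContinuum.HydrodynamicLimit.Theorems
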